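import Summits.CriticalPhenomena.PercolationContinuityZ3.Theorems.PercNearOneGluingNoHeavyLowerTailKnQuestion8CoefficientwiseMirror
import HarnessLib

/-!
# The two-sided cell bound: a two-sided cell is dominated by its one-sided companion

Support file (`--supports stmt-CriticalPhenomena-4575`, closed), prover `prim-cplus-coupling` (gen 28).  No definitions, no notations, no named
facts, no sorries; standard axioms.  Memo `prim-cplus-coupling/A5-COUPLING-gen28.md` §2.5.

In every decomposition of the first-rung / SUPER sums along the zone of the conditioning vertex (prim-cplus-coupling gens 22–28, prim-lf-2 CW-TLEMMA) the obstruction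
is the TWO-SIDED CELL: a free cube `{t | t ∩ B = π}` on which the cluster pair of `x` is `X(t) = (C_x(t_free ∪ R), C_x(t_freeᶜ ∪ B'))` with BOTH a forced red set `R`
and a forced blue set `B'`; its sum `Σ ψ₁(X)ψ₂(X)` is unsigned.  Its ONE-SIDED COMPANION `X₀(t) = (C_x(t_free), C_x(t_freeᶜ ∪ R ∪ B'))` satisfies
`X₀(t) ≤_tw X(t) ≤_tw X₀(τ t)^sw` (`τ` = flip of the free coordinates), hence for a mirror test function `Φ₀ := ψ∘X₀ ≤ Φ := ψ∘X ≤ −Φ₀∘τ`.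
* `Coefficientwise.twoSided_cell_bound` — ABSTRACT FORM: on a cell, for monotone `Φ₀, Φ, Γ₀, Γ : Finset ι → ℝ` with `Φ₀ ≤ Φ ≤ −Φ₀∘τ` and `Γ₀ ≤ Γ ≤ −Γ₀∘τ` on the cell,
  `0 ≤ Σ_{cell} (Φ₀Γ₀ + ΦΓ)`.  Proof: Harris (`fkg_cell`) on each product and `|Σ Φ| ≤ −Σ Φ₀`, `|Σ Γ| ≤ −Σ Γ₀`.
  So the (possibly negative) sum of any two-sided cell is paid for by the sum of its one-sided companion; in particular the cell advantages satisfy `|m(ψ; X)| ≤ −m(ψ; X₀)`.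
  Used (memo §3 REFINEMENTS) to prove the 'unlinked, non-adjacent' part of conjecture SUPER for a conditioning vertex of degree 2, where the half-zone flip pairs every
  two-sided cell with a realised one-sided companion cell on the same free cube.
[cite: KozmaNitzan2024, Questions 8–9 (§5.5 p. 36) (context: the Question-8 pocket covariance programme)]
-/

namespace Summit.CriticalPhenomena.PercolationContinuityZ3.Theorems

open Finset Literature.Probability.Percolation

namespace Coefficientwise

variable {ι : Type*} [Fintype ι] [DecidableEq ι]

/-- **Two-sided cell bound.**  On the cell `{t | t ∩ B = π}` (`π ⊆ B`) with free flip `τ t = π ∪ (tᶜ \ B)`: if `Φ₀, Φ, Γ₀, Γ` are monotone and on the cell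
`Φ₀ t ≤ Φ t ≤ -Φ₀ (τ t)`, `Γ₀ t ≤ Γ t ≤ -Γ₀ (τ t)`, then `0 ≤ Σ_{cell} (Φ₀ t·Γ₀ t + Φ t·Γ t)`.  (Harris twice: `|cell|·ΣΦΓ ≥ ΣΦ·ΣΓ ≥ −ΣΦ₀·ΣΓ₀ ≥ −|cell|·ΣΦ₀Γ₀`,
using `ΣΦ₀, ΣΓ₀ ≤ 0` and `|ΣΦ| ≤ −ΣΦ₀`, `|ΣΓ| ≤ −ΣΓ₀`.) [this work] -/
theorem twoSided_cell_bound (B π : Finset ι) (hπ : π ⊆ B) (Φ₀ Φ Γ₀ Γ : Finset ι → ℝ)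
    (hΦ₀ : Monotone Φ₀) (hΦ : Monotone Φ) (hΓ₀ : Monotone Γ₀) (hΓ : Monotone Γ)
    (lΦ : ∀ t : Finset ι, t ∩ B = π → Φ₀ t ≤ Φ t) (uΦ : ∀ t : Finset ι, t ∩ B = π → Φ t ≤ -Φ₀ (π ∪ (tᶜ \ B)))
    (lΓ : ∀ t : Finset ι, t ∩ B = π → Γ₀ t ≤ Γ t) (uΓ : ∀ t : Finset ι, t ∩ B = π → Γ t ≤ -Γ₀ (π ∪ (tᶜ \ B))) :
    0 ≤ ∑ t ∈ univ.filter (fun t : Finset ι => t ∩ B = π), (Φ₀ t * Γ₀ t + Φ t * Γ t) := by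
  set cell := univ.filter (fun t : Finset ι => t ∩ B = π) with hcell
  have mem_cell : ∀ t : Finset ι, t ∈ cell ↔ t ∩ B = π := fun t => by simp [hcell]
  -- the free flip is a bijection of the cell
  set τ : Finset ι → Finset ι := fun t => π ∪ (tᶜ \ B) with hτ
  have facts : ∀ t : Finset ι, t ∩ B = π → ∀ i, (i ∈ π ↔ i ∈ t ∧ i ∈ B) := fun t ht i => by
    rw [← ht]; exact Finset.mem_inter
  have memτ : ∀ t i, i ∈ τ t ↔ i ∈ π ∨ (i ∉ t ∧ i ∉ B) := fun t i => by
    simp only [hτ, Finset.mem_union, Finset.mem_sdiff, Finset.mem_compl]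
  have hτcell : ∀ t, t ∩ B = π → τ t ∩ B = π := by
    intro t ht; ext i; simp only [Finset.mem_inter, memτ]
    have h1 := facts t ht i; have h2 : i ∈ π → i ∈ B := fun h => hπ h; tauto
  have hττ : ∀ t, t ∩ B = π → τ (τ t) = t := by
    intro t ht; ext i; rw [memτ, memτ]
    have h1 := facts t ht i; have h2 : i ∈ π → i ∈ B := fun h => hπ h; tauto
  have reindex : ∀ H : Finset ι → ℝ, ∑ t ∈ cell, H (τ t) = ∑ t ∈ cell, H t := by
    intro H
    refine Finset.sum_bij' (fun t _ => τ t) (fun t _ => τ t) ?_ ?_ ?_ ?_ ?_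
    · intro t ht; exact (mem_cell _).mpr (hτcell t ((mem_cell t).mp ht))
    · intro t ht; exact (mem_cell _).mpr (hτcell t ((mem_cell t).mp ht))
    · intro t ht; exact hττ t ((mem_cell t).mp ht)
    · intro t ht; exact hττ t ((mem_cell t).mp ht)
    · intro t ht; rfl
  -- mean bounds
  have sΦ_lo : ∑ t ∈ cell, Φ₀ t ≤ ∑ t ∈ cell, Φ t := Finset.sum_le_sum fun t ht => lΦ t ((mem_cell t).mp ht)
  have sΦ_hi : ∑ t ∈ cell, Φ t ≤ -∑ t ∈ cell, Φ₀ t := by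
    rw [← reindex Φ₀, ← Finset.sum_neg_distrib]
    exact Finset.sum_le_sum fun t ht => uΦ t ((mem_cell t).mp ht)
  have sΓ_lo : ∑ t ∈ cell, Γ₀ t ≤ ∑ t ∈ cell, Γ t := Finset.sum_le_sum fun t ht => lΓ t ((mem_cell t).mp ht)
  have sΓ_hi : ∑ t ∈ cell, Γ t ≤ -∑ t ∈ cell, Γ₀ t := by
    rw [← reindex Γ₀, ← Finset.sum_neg_distrib]
    exact Finset.sum_le_sum fun t ht => uΓ t ((mem_cell t).mp ht)
  -- Harris on the cell, twice
  have k0 := fkg_cell B π Φ₀ Γ₀ hΦ₀ hΓ₀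
  have k1 := fkg_cell B π Φ Γ hΦ hΓ
  -- product of the means: (ΣΦ)(ΣΓ) ≥ -(ΣΦ₀)(ΣΓ₀)
  have hprod : (∑ t ∈ cell, Φ₀ t) * (∑ t ∈ cell, Γ₀ t) + (∑ t ∈ cell, Φ t) * (∑ t ∈ cell, Γ t) ≥ 0 := by
    set p := ∑ t ∈ cell, Φ₀ t; set q := ∑ t ∈ cell, Γ₀ t; set u := ∑ t ∈ cell, Φ t; set v := ∑ t ∈ cell, Γ t
    have hp : p ≤ 0 := by linarith
    have hq : q ≤ 0 := by linarith
    -- u ∈ [p, -p], v ∈ [q, -q]  ⟹  u v ≥ p q·(-1)… precisely u*v ≥ -(p*q)... and p*q ≥ 0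
    nlinarith [mul_nonneg (sub_nonneg.mpr sΦ_lo) (sub_nonneg.mpr sΓ_lo), mul_nonneg (sub_nonneg.mpr sΦ_hi) (sub_nonneg.mpr sΓ_hi),
      mul_nonneg (sub_nonneg.mpr sΦ_lo) (sub_nonneg.mpr sΓ_hi), mul_nonneg (sub_nonneg.mpr sΦ_hi) (sub_nonneg.mpr sΓ_lo)]
  rw [Finset.sum_add_distrib]
  rcases cell.eq_empty_or_nonempty with hce | hne
  · simp [hce]
  · have hcard : (0 : ℝ) < (cell.card : ℝ) := by exact_mod_cast hne.card_pos
    have h1 : (cell.card : ℝ) * (∑ t ∈ cell, Φ₀ t * Γ₀ t + ∑ t ∈ cell, Φ t * Γ t) ≥ 0 := by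
      have := add_le_add k0 k1
      nlinarith [this, hprod]
    by_contra hlt
    have hlt' : ∑ t ∈ cell, Φ₀ t * Γ₀ t + ∑ t ∈ cell, Φ t * Γ t < 0 := lt_of_not_ge hlt
    have : (cell.card : ℝ) * (∑ t ∈ cell, Φ₀ t * Γ₀ t + ∑ t ∈ cell, Φ t * Γ t) < 0 := mul_neg_of_pos_of_neg hcard hlt'
    linarith

end Coefficientwise

end Summit.CriticalPhenomena.PercolationContinuityZ3.Theorems
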